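import Mathlib
import Literature.Computability.Complexity.Classes
import Literature.Computability.MetaComplexity.Hirahara2020.MKtPConstantDepthLowerBounds
import Literature.Computability.MetaComplexity.MCSPStatisticalTest
import HarnessLib

/-!
# Hirahara (CCC 2020; ToC 2023), Thm. 4.29 and Thm. 1.11 item 1 / Prop. 4.22: the non-disjoint
# promise problem `E vs SIZE(2^{αn})` and hitting set generators secure against `AC⁰_d ∘ XOR`

S. Hirahara, *Non-disjoint promise problems from meta-computational view of pseudorandom generator
constructions*, Theory of Computing **19**(4) (2023) 1–61 (bib key `Hirahara2023NonDisjoint`;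
conference version 35th CCC (2020), LIPIcs 169, 20:1–20:47, where Thm. 4.29 is numbered Thm. 61 and
Prop. 4.22 is Prop. 54). ALL QUOTATIONS AND LOCATORS ARE FROM THE JOURNAL VERSION. This is the
sibling of `Hirahara2020/MKtPConstantDepthLowerBounds.lean` (Thm. 1.11 items 3 ⟺ 4, `Thm111Item3`,
`Thm111Item4`), adding the two notions that file leaves in prose — the META-COMPUTATIONAL CIRCUIT
LOWER-BOUND PROBLEM `E vs SIZE(2^{αn})` (a NON-DISJOINT promise problem) and HITTING SET GENERATORS —
for hardness-magnification census row **R29** (= Thm. 4.29: a nearly-linear `AC⁰_{d+1} ∘ XOR` lower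
bound for `E vs SIZE(2^{αn})` yields a hitting set generator secure against linear-size `AC⁰_d ∘ XOR`).

## The printed statements (verbatim)

p. 21 (§2.2): *"we say that D ε-avoids G if Pr_{w∼{0,1}^m}[D(w) = 1] ≥ ε and D(G(z)) = 0 for every
z ∈ {0,1}^d. By default, we assume that ε := 1/2."* and *"We say that G is a hitting set generator
secure against ℭ if for all large n ∈ ℕ, there is no circuit D ∈ ℭ on n inputs that avoids G_n."*
p. 34, Def. 4.10: *"Let ℰ, 𝒟 be families of functions. The ℰ vs 𝒟 Problem is defined as the
following promise problem (Π_Yes, Π_No). Π_Yes := { tt(f) | f ∈ ℰ }, Π_No := { tt(f) | f ∉ 𝒟 }."*;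
p. 34: *"We denote by (E vs 𝒟) a family of problems {E^c vs 𝒟}_{c∈ℕ}, where
E^c := ⋃_{n∈ℕ} DTIME(2^{cn})/_n cn."*; p. 34: *"we say that (E vs 𝒟) is solved by a ℭ-circuit of
size s(N) and denote by (E vs 𝒟) ∈ i.o.ℭ(s(N)) if, for every constant c, there exists a family of
ℭ-circuits {C_N}_{N∈ℕ} of size s(N) such that C_N solves the promise problem (E^c vs 𝒟)_N for
infinitely many N."*; p. 34, Fact 4.9: *"For any function t : ℕ → ℕ such that t(n) ≥ n and for any
family of functions f = {f_n : {0,1}^n → {0,1}}_{n∈ℕ}, the following are equivalent. 1. f_n ∈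
DTIME(t(n)^{O(1)})/_n O(log t(n)) for all large n ∈ ℕ. 2. Kt(f_n) = O(log t(n)) for all large
n ∈ ℕ."*

**Theorem 4.29** (p. 43; CCC Thm. 61): *"Let d be a constant. Suppose that (E vs SIZE(2^{αn})) ∉
i.o.AC⁰_{d+1} ∘ XOR(N^{1+β}) for some constants α, β > 0. Then, there exists a hitting set generator
G = {G_n : {0,1}^{O(log n)} → {0,1}^n}_{n∈ℕ} computable in time n^{O(1)} and secure against
linear-size AC⁰_d ∘ XOR circuits."*

**Theorem 1.11, item 1** (p. 44, Restatement): *"For any constant d, there exists a hitting set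
generator G = {G_n : {0,1}^{O(log n)} → {0,1}^n}_{n∈ℕ} computable in time n^{O(1)} and secure
against linear-size AC⁰_d ∘ XOR circuits."*; proof of Thm. 1.11, p. 44: *"The implication from
Item 2 to Item 1 immediately follows from Theorem 4.29. The implication from Item 1 to Item 4 is a
standard approach for showing a lower bound for MKtP, and follows from Proposition 4.22."*

**Proposition 4.22** (p. 39; CCC Prop. 54): *"Let ℭ be any circuit complexity class. Suppose that
there exists a hitting set generator G = {G_n : {0,1}^{O(log n)} → {0,1}^n}_{n∈ℕ} computable in
time n^{O(1)} and secure against linear-size ℭ circuits. Then, for any constant k ∈ ℕ, for all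
sufficiently large N ∈ ℕ, no NOT ∘ ℭ circuit of size N^k can solve […] MKtP[O(log N), N − 1] on
input length N."*

## Rendering (F-rule: every modelling choice is on the safe side or exact)

* `E^c` VIA `Kt` (Fact 4.9). The tree has no time-with-length-wise-advice classes; by Fact 4.9
  with `t(n) = 2^{cn}`, `f ∈ E^c` for all large `n` iff `Kt(tt(f_n)) = O(cn) = O(c·log N)`,
  `N = 2^n`. The YES side of `EvsSIZE U c α` is therefore `{x : |x| = 2^n, Kt_U(x) ≤ c·⌊log₂|x|⌋}`
  (the sibling file's `logThreshold c`). At the level of the FAMILY `{E^c vs 𝒟}_{c∈ℕ}` — and the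
  printed hypothesis quantifies `∃ c` after negating the `i.o.` clause — this re-indexes `c` by a
  constant factor: a `U`-program of length `≤ c log N` running in time `2^{c log N}` is a
  `DTIME(2^{O(c)n})` machine with `O(cn)` bits of advice (by `UniversalMachine.polyTime`), so every
  typed YES instance is a printed YES instance of `E^{O(c)}`; hence the typed hypothesis (a lower
  bound for the typed problem, which has the LARGER promise) implies the printed one — the safe
  direction for a hypothesis. The NO side is exact: `tt(f)` with `f ∉ SIZE(2^{αn})`, i.e.
  `⌊2^{αn}⌋ < circuitSizeOver B2 f` (`powThreshold α (2^n) = ⌊(2^n)^α⌋₊`; gate count over `B₂`,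
  p. 21 *"We measure circuit size by the number of gates (except for the input gates)"*; a change of
  complete binary basis rescales size by a constant, absorbed by `∃ α > 0`).
* `i.o.` ALONG POWERS OF TWO. Instances are truth tables, so `(E^c vs 𝒟)_N` is read at `N = 2^n`;
  `PromiseProblem.EventuallyUnsolvablePow2 Q P` says: for all large `n`, no `2^n`-input circuit with
  `P (2^n)` solves `Q` at length `2^n` — the pointwise reading of the sibling files
  (`Circuit.SolvesPromise`, `PromiseProblem.EventuallyUnsolvable`, of which it is the restriction to
  the subsequence `2^n`, `eventuallyUnsolvablePow2_of_eventuallyUnsolvable`). Reading `∉ i.o.` at ALL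
  lengths would make the hypothesis FALSE (no NO instance has a length that is not a power of two,
  so the constant-`true` circuit solves the problem there), not vacuous.
* HITTING SET GENERATORS. `G_n(z) := F(⟨1^n, z⟩)` for a polynomial-time `F ∈ FP` (*"computable in time
  n^{O(1)}"*: polynomial in `|⟨1^n, z⟩| = Θ(n + |z|)`), seeds `|z| ≤ c·⌊log₂ n⌋ + c` (*"{0,1}^{O(log n)}"*;
  allowing all shorter seeds and reading the first `n` output bits with padding are equivalent
  conventions up to an `FP` re-encoding), density `Pr[D = 1] ≥ 1/2` as `2^n ≤ 2·#{u | D(u) = 1}`.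
  The distinguisher class is the sibling file's `IsACdXor d (fun n ↦ n)` (*"linear-size AC⁰_d ∘ XOR"*
  read as size `≤ n`; negations are free in the tree's `acXorBasis`). On the HYPOTHESIS side of
  Prop. 4.22 this class contains the printed one, the safe direction. On the CONCLUSION side of
  Thm. 4.29 the printed security transfers to it by two routine steps not formalised here: De Morgan
  normalisation (negations pushed to the literals feeding the bottom parities, size unchanged up to a
  constant factor `k`) and input restriction (security of `G_{kn}` against size-`kn` circuits on `kn`
  inputs that read only the first `n` inputs gives a generator `z ↦ G_{kn}(z)↾n` secure against
  size-`kn` circuits on `n` inputs, still with `O(log n)` seed and polynomial time).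
* `Prop. 4.22` is vendored for `ℭ = AC⁰_d ∘ XOR` (the instance used in the proof of Thm. 1.11), with
  `NOT ∘ ℭ = ℭ` in the tree's model (free negations) and the MKtP conclusion only, as
  `prop422_acdXor`; its `E vs SIZE(2^{αn}; 1 − 2^{−αn})` conclusion (a δ-dense variant of the MCLP) is
  not typed.

## What is proved here (no `sorry`)

`eventuallyUnsolvablePow2_of_eventuallyUnsolvable` (restriction to `N = 2^n`);
`thm111Item4_of_item1` (Prop. 4.22 ⟹ Item 1 ⟹ Item 4, for EVERY reference machine, using the
sibling file's `eventually_powThreshold_lt_predThreshold`); `not_EXP_subset_NC1_of_thm429Hypothesis`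
(Thm. 4.29 + Prop. 4.22 + the sibling's `thm111_consequence`: the R29 hypothesis at all depths
magnifies to `EXP ⊄ NC¹`); non-degeneracy: `exists_forall_ones_mem_EvsSIZE_yes` (YES instances `1^{2^n}`
for `c ≥ c₀(U)`), `exists_truthTable_mem_EvsSIZE_no` (NO instances of length `2^{2j}`, `j ≥ 5`, for
every `α ≤ 1/2`, by the tree's circuit count `two_mul_card_filter_circuitSizeOver_le_sqrt`),
`EvsSIZE_no_anti` (NO side antitone in `α`), and `not_isHittingSetGeneratorAgainst_zero` (the HSG
notion is a genuine constraint: the all-zero generator is avoided by the dense one-gate-free circuit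
`x₀`, which lies in `IsACdXor d (fun n ↦ n)`).
-/

namespace Literature.Computability.MetaComplexity.Hirahara2020

open _root_.Computability Filter Topology Literature.Computability.Complexity
open Literature.Computability.MetaComplexity UniversalMachine OliveiraPichSanthanam2019 Finset

/-! ### Definitions -/

/-- **`Q ∉ i.o.{P-circuits}` along powers of two**: for all sufficiently large `n`, no `2^n`-input
circuit `E` with `P (2^n) E` solves `Q` at length `2^n` — the reading of *"C_N solves the promise
problem (E^c vs 𝒟)_N for infinitely many N"* (negated) for problems whose instances are truth tables
(`N = 2^n`). Deliberate dot-notation extension of `Complexity.PromiseProblem`.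
[cite: Hirahara2023NonDisjoint, §4.3 p. 34 ((E vs 𝒟) ∈ i.o.ℭ(s(N)))] -/
def _root_.Literature.Computability.Complexity.PromiseProblem.EventuallyUnsolvablePow2
    (Q : PromiseProblem) (P : ∀ N : ℕ, Circuit (Fin N) → Prop) : Prop :=
  ∀ᶠ n : ℕ in atTop, ∀ E : Circuit (Fin (2 ^ n)), P (2 ^ n) E → ¬ E.SolvesPromise Q

/-- **The MCLP `E^c vs SIZE(2^{αn})`** (Def. 4.10 with `ℰ = E^c`, `𝒟 = SIZE(2^{αn})`) for the reference
machine `U`: YES instances are the strings of length `N = 2^n` with `Kt_U(x) ≤ c·⌊log₂ N⌋` (the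
`Kt`-rendering of `tt(f)`, `f ∈ E^c = ⋃ₙ DTIME(2^{cn})/_n cn`, by Fact 4.9 — module docstring,
RENDERING); NO instances are the truth tables `tt(f)` of functions `f : {0,1}^n → {0,1}` with
`f ∉ SIZE(2^{αn})`, i.e. `⌊2^{αn}⌋ < circuitSizeOver B2 f`. The two sides are in general NOT disjoint
(*"non-disjoint promise problem"*). [cite: Hirahara2023NonDisjoint, Def. 4.10 and §4.3 p. 34 (E^c vs SIZE(2^{αn})), Fact 4.9] -/
def EvsSIZE (U : UniversalMachine) (c : ℕ) (α : ℝ) : PromiseProblem :=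
  ⟨{x | (∃ n : ℕ, x.length = 2 ^ n) ∧ U.levinKt x ≤ (logThreshold c x.length : ℕ)},
    {x | ∃ (n : ℕ) (f : (Fin n → Bool) → Bool), x = truthTable f ∧
      powThreshold α (2 ^ n) < circuitSizeOver B2 f}⟩

/-- The `n`-bit input read off a string: its first `n` bits, padded with `false`. [folklore] -/
def toInput (n : ℕ) (w : List Bool) : Fin n → Bool := fun i => w.getD i false

/-- **`D` avoids the set `S ⊆ {0,1}^n`** (with the default `ε = 1/2`): `Pr_{w∼{0,1}^n}[D(w) = 1] ≥ 1/2`,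
i.e. `2^n ≤ 2·#{u | D(u) = 1}`, and `D(u) = 0` for every `u ∈ S`. Deliberate dot-notation extension of
`Complexity.Circuit`. [cite: Hirahara2023NonDisjoint, §2.2 p. 21 ("D ε-avoids G", ε := 1/2)] -/
def _root_.Literature.Computability.Complexity.Circuit.Avoids {n : ℕ} (D : Circuit (Fin n))
    (S : Set (Fin n → Bool)) : Prop :=
  2 ^ n ≤ 2 * (Finset.univ.filter fun u : Fin n → Bool => D.eval u = true).card ∧
    ∀ u ∈ S, D.eval u = false

/-- The image of the generator `G` at output length `n` on the seeds of length `≤ ℓ`, as a set of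
`n`-bit inputs. [cite: Hirahara2023NonDisjoint, §2.2 p. 21 (G_n : {0,1}^{s(n)} → {0,1}^n)] -/
def seedImage (G : ℕ → List Bool → List Bool) (ℓ n : ℕ) : Set (Fin n → Bool) :=
  {u | ∃ z : List Bool, z.length ≤ ℓ ∧ u = toInput n (G n z)}

/-- **`G` is a hitting set generator secure against `P`-circuits** with seed length `ℓ`: for all large
`n`, no `n`-input circuit `D` with `P n D` avoids `G_n` on seeds of length `≤ ℓ(n)`.
[cite: Hirahara2023NonDisjoint, §2.2 p. 21 ("hitting set generator secure against ℭ")] -/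
def IsHittingSetGeneratorAgainst (P : ∀ n : ℕ, Circuit (Fin n) → Prop)
    (G : ℕ → List Bool → List Bool) (ℓ : ℕ → ℕ) : Prop :=
  ∀ᶠ n : ℕ in atTop, ∀ D : Circuit (Fin n), P n D → ¬ D.Avoids (seedImage G (ℓ n) n)

/-- **Thm. 1.11 item 1 at depth `d`**: there is a hitting set generator `G_n : {0,1}^{O(log n)} → {0,1}^n`
computable in time `n^{O(1)}` — rendered `G_n(z) = F(⟨1^n, z⟩)` with `F ∈ FP`, seeds of length
`≤ c·⌊log₂ n⌋ + c` — secure against linear-size `AC⁰_d ∘ XOR` circuits (the sibling file's constraint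
`IsACdXor d (fun n ↦ n)`; module docstring, RENDERING).
[cite: Hirahara2023NonDisjoint, Thm. 1.11 item 1 (Restatement, p. 44) and Thm. 4.29 (conclusion)] -/
def HSGAgainstLinearACdXor (d : ℕ) : Prop :=
  ∃ (F : List Bool → List Bool) (c : ℕ), F ∈ FP ∧
    IsHittingSetGeneratorAgainst (IsACdXor d fun n => n)
      (fun n z => F (boolPair (unaryEncodeNat n) z)) (fun n => c * Nat.log 2 n + c)

/-- **Thm. 1.11, item 1** (all depths): *"For any constant d, there exists a hitting set generator …
secure against linear-size AC⁰_d ∘ XOR circuits."* [cite: Hirahara2023NonDisjoint, Thm. 1.11 item 1 (Restatement, p. 44)] -/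
def Thm111Item1 : Prop := ∀ d : ℕ, HSGAgainstLinearACdXor d

/-- **The hypothesis of Thm. 4.29 at depth `d`** for the machine `U`: *"(E vs SIZE(2^{αn})) ∉
i.o.AC⁰_{d+1} ∘ XOR(N^{1+β}) for some constants α, β > 0"* — by the `i.o.` convention of p. 34, SOME
member `E^c vs SIZE(2^{αn})` of the family is solved at length `N = 2^n`, for all large `n`, by no
`AC⁰_{d+1} ∘ XOR` circuit of size `N^{1+β}` (`powSize (1 + β) N = ⌊N^{1+β}⌋₊`).
[cite: Hirahara2023NonDisjoint, Thm. 4.29 (hypothesis) and §4.3 p. 34] -/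
def Thm429Hypothesis (U : UniversalMachine) (d : ℕ) : Prop :=
  ∃ α β : ℝ, 0 < α ∧ 0 < β ∧ ∃ c : ℕ,
    (EvsSIZE U c α).EventuallyUnsolvablePow2 (IsACdXor (d + 1) (powSize (1 + β)))

/-! ### The named facts (published theorems, vendored unproved as `Prop`s) -/

/-- **Thm. 4.29** (CCC Thm. 61), for every reference machine: a nearly-linear `AC⁰_{d+1} ∘ XOR` lower
bound for `E vs SIZE(2^{αn})` yields a polynomial-time hitting set generator with logarithmic seed
secure against linear-size `AC⁰_d ∘ XOR` circuits. Census row R29 (hypothesis side; the conclusion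
is a pseudorandom object, not a class separation). [cite: Hirahara2023NonDisjoint, Thm. 4.29 (p. 43)] -/
def thm429 : Prop := ∀ (U : UniversalMachine) (d : ℕ), Thm429Hypothesis U d → HSGAgainstLinearACdXor d

/-- **Prop. 4.22 for `ℭ = AC⁰_d ∘ XOR`** (the instance used in the proof of Thm. 1.11, Item 1 ⟹ Item 4;
`NOT ∘ ℭ = ℭ` for this class), for every reference machine: a hitting set generator secure against
linear-size `AC⁰_d ∘ XOR` circuits gives, for every `k`, a member `MKtP[c log N, N − 1]` that for all
large `N` no `AC⁰_d ∘ XOR` circuit of size `N^k` solves at length `N` (the sibling file's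
`predThreshold`). Hypothesis-side class (referee F31): security against `AC⁰_d ∘ XOR` circuits of
size at most the input length (`IsACdXor d (fun n ↦ n)`) is what the printed PROOF consumes, not a
class containment — the solver `C` of size `N^k` is re-read on `m := N^k` inputs, *"We regard C as a
circuit that takes m := N^k input bits by ignoring m − N input bits"*, whence *"the linear-size
circuit C avoids G_m"* (p. 40 L6–7); the typed fact is therefore the theorem the proof establishes
(security against size `≤ m` suffices), formally stronger than Prop. 4.22 read with
"linear = O(m)"-security. Statement unchanged.
[cite: Hirahara2023NonDisjoint, Prop. 4.22 (p. 39), its proof (p. 40 L6–7) and proof of Thm. 1.11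
(p. 44)] -/
def prop422_acdXor : Prop := ∀ (U : UniversalMachine) (d : ℕ), HSGAgainstLinearACdXor d →
  ∀ k : ℕ, ∃ c : ℕ,
    (U.gapMKtP (logThreshold c) predThreshold).EventuallyUnsolvable (IsACdXor d fun N => N ^ k)

/-! ### Unfolding and restriction -/

/-- `Q ∉ i.o.` along powers of two iff from some exponent `n₀` on no admissible `2^n`-input circuit
solves `Q`. [folklore] -/
theorem eventuallyUnsolvablePow2_iff {Q : PromiseProblem} {P : ∀ N : ℕ, Circuit (Fin N) → Prop} :
    Q.EventuallyUnsolvablePow2 P ↔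
      ∃ n₀ : ℕ, ∀ n : ℕ, n₀ ≤ n → ∀ E : Circuit (Fin (2 ^ n)), P (2 ^ n) E → ¬ E.SolvesPromise Q := by
  unfold PromiseProblem.EventuallyUnsolvablePow2
  rw [eventually_atTop]

/-- The all-lengths bound restricts to the subsequence of powers of two. [folklore] -/
theorem eventuallyUnsolvablePow2_of_eventuallyUnsolvable {Q : PromiseProblem}
    {P : ∀ N : ℕ, Circuit (Fin N) → Prop} (h : Q.EventuallyUnsolvable P) :
    Q.EventuallyUnsolvablePow2 P := by
  obtain ⟨N₀, hN₀⟩ := eventuallyUnsolvable_iff.1 h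
  refine eventuallyUnsolvablePow2_iff.2 ⟨N₀, fun n hn E hE => hN₀ (2 ^ n) ?_ E hE⟩
  exact hn.trans (Nat.lt_two_pow_self).le

/-! ### Membership in the two sides of `E^c vs SIZE(2^{αn})` -/

/-- YES membership. [cite: Hirahara2023NonDisjoint, Def. 4.10, Fact 4.9] -/
theorem mem_EvsSIZE_yes_iff {U : UniversalMachine} {c : ℕ} {α : ℝ} {x : List Bool} :
    x ∈ (EvsSIZE U c α).yes ↔
      (∃ n : ℕ, x.length = 2 ^ n) ∧ U.levinKt x ≤ (logThreshold c x.length : ℕ) := Iff.rfl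

/-- NO membership. [cite: Hirahara2023NonDisjoint, Def. 4.10] -/
theorem mem_EvsSIZE_no_iff {U : UniversalMachine} {c : ℕ} {α : ℝ} {x : List Bool} :
    x ∈ (EvsSIZE U c α).no ↔ ∃ (n : ℕ) (f : (Fin n → Bool) → Bool), x = truthTable f ∧
      powThreshold α (2 ^ n) < circuitSizeOver B2 f := Iff.rfl

/-- Every NO instance has length a power of two. [folklore] -/
theorem exists_length_eq_two_pow_of_mem_no {U : UniversalMachine} {c : ℕ} {α : ℝ} {x : List Bool}
    (hx : x ∈ (EvsSIZE U c α).no) : ∃ n : ℕ, x.length = 2 ^ n := by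
  obtain ⟨n, f, rfl, -⟩ := hx
  exact ⟨n, length_truthTable f⟩

/-- The NO side is ANTITONE in `α`: a function outside `SIZE(2^{α'n})` is outside `SIZE(2^{αn})` for
`α ≤ α'`. [folklore] -/
theorem EvsSIZE_no_anti (U : UniversalMachine) (c : ℕ) {α α' : ℝ} (h : α ≤ α') :
    (EvsSIZE U c α').no ≤ (EvsSIZE U c α).no := by
  intro x hx
  obtain ⟨n, f, rfl, hf⟩ := hx
  refine ⟨n, f, rfl, lt_of_le_of_lt ?_ hf⟩
  unfold powThreshold
  refine Nat.floor_le_floor (Real.rpow_le_rpow_of_exponent_le ?_ h)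
  exact_mod_cast Nat.one_le_two_pow

/-! ### Non-degeneracy of the hypothesis: both sides are inhabited at large lengths -/

/-- **YES side inhabited**: there is `c₀` (depending on `U`) such that for all `c ≥ c₀`, every `α` and
every `n ≥ 1`, the string `1^{2^n}` is a YES instance of `E^c vs SIZE(2^{αn})` (the sibling file's
`exists_forall_ones_mem_yes`: `Kt(1^N) ≤ c₀ log N`). [folklore] -/
theorem exists_forall_ones_mem_EvsSIZE_yes (U : UniversalMachine) :
    ∃ c₀ : ℕ, ∀ c : ℕ, c₀ ≤ c → ∀ (α : ℝ) (n : ℕ), 1 ≤ n →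
      ones (2 ^ n) ∈ (EvsSIZE U c α).yes := by
  obtain ⟨c₀, hc₀⟩ := exists_forall_ones_mem_yes U
  refine ⟨c₀, fun c hc α n hn => ?_⟩
  have h2 : 2 ≤ 2 ^ n := by
    calc (2 : ℕ) = 2 ^ 1 := by norm_num
      _ ≤ 2 ^ n := Nat.pow_le_pow_right (by norm_num) hn
  have hyes := hc₀ c hc predThreshold (2 ^ n) h2
  rw [UniversalMachine.gapMKtP_yes] at hyes
  refine ⟨⟨n, by simp [ones]⟩, ?_⟩
  have hyes' : U.levinKt (ones (2 ^ n)) ≤ (logThreshold c (ones (2 ^ n)).length : ℕ) := hyes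
  simpa [ones] using hyes'

/-- `⌊(2^{2j})^α⌋ ≤ 2^j` for `α ≤ 1/2`. [folklore] -/
theorem powThreshold_two_pow_two_mul_le {α : ℝ} (hα : α ≤ 1 / 2) (j : ℕ) :
    powThreshold α (2 ^ (2 * j)) ≤ 2 ^ j := by
  unfold powThreshold
  have hbase : (1 : ℝ) ≤ ((2 ^ (2 * j) : ℕ) : ℝ) := by exact_mod_cast Nat.one_le_two_pow
  have hle : ((2 ^ (2 * j) : ℕ) : ℝ) ^ α ≤ ((2 ^ (2 * j) : ℕ) : ℝ) ^ ((1 : ℝ) / 2) :=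
    Real.rpow_le_rpow_of_exponent_le hbase hα
  have heq : ((2 ^ (2 * j) : ℕ) : ℝ) ^ ((1 : ℝ) / 2) = ((2 ^ j : ℕ) : ℝ) := by
    push_cast
    rw [← Real.rpow_natCast (2 : ℝ) (2 * j), ← Real.rpow_mul (by norm_num : (0 : ℝ) ≤ 2),
      ← Real.rpow_natCast (2 : ℝ) j]
    congr 1
    push_cast
    ring
  rw [heq] at hle
  calc ⌊((2 ^ (2 * j) : ℕ) : ℝ) ^ α⌋₊ ≤ ⌊((2 ^ j : ℕ) : ℝ)⌋₊ := Nat.floor_le_floor hle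
    _ = 2 ^ j := by rw [Nat.floor_natCast]

/-- **NO side inhabited**: for every `α ≤ 1/2` and every `j ≥ 5`, some function on `2j` variables has
`B₂`-circuit complexity `> ⌊2^{α·2j}⌋` — at most half of all functions have complexity `≤ 2^j = √N`
(`two_mul_card_filter_circuitSizeOver_le_sqrt`), and `⌊N^α⌋ ≤ √N`. So `E^c vs SIZE(2^{αn})` has NO
instances of every length `2^{2j}`, `j ≥ 5`. [folklore] -/
theorem exists_truthTable_mem_EvsSIZE_no (U : UniversalMachine) (c : ℕ) {α : ℝ} (hα : α ≤ 1 / 2)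
    {j : ℕ} (hj : 5 ≤ j) :
    ∃ f : (Fin (2 * j) → Bool) → Bool, truthTable f ∈ (EvsSIZE U c α).no := by
  classical
  by_contra hcon
  push Not at hcon
  -- every function has complexity ≤ 2^j
  have hall : ∀ f : (Fin (2 * j) → Bool) → Bool,
      circuitSizeOver B2 f ≤ Nat.sqrt (2 ^ (2 * j)) := by
    intro f
    rw [sqrt_two_pow_two_mul]
    by_contra hf
    push Not at hf
    exact hcon f ⟨2 * j, f, rfl, lt_of_le_of_lt (powThreshold_two_pow_two_mul_le hα j) hf⟩
  have hcard : (Finset.univ.filter fun f : (Fin (2 * j) → Bool) → Bool =>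
      circuitSizeOver B2 f ≤ Nat.sqrt (2 ^ (2 * j))).card = 2 ^ 2 ^ (2 * j) := by
    rw [Finset.filter_true_of_mem (fun f _ => hall f)]
    simp
  have hsmall := two_mul_card_filter_circuitSizeOver_le_sqrt hj
  rw [hcard] at hsmall
  have hpos : 0 < 2 ^ 2 ^ (2 * j) := pow_pos (by norm_num) _
  omega

/-- Hence at every length `N = 2^{2j}`, `j ≥ 5`, and for `c ≥ c₀(U)`, `α ≤ 1/2`, BOTH sides of
`E^c vs SIZE(2^{αn})` have an instance of length `N`: neither constant circuit solves the problem there,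
so the typed hypothesis `Thm429Hypothesis` is not made true by an empty side. [folklore] -/
theorem EvsSIZE_nondegenerate (U : UniversalMachine) :
    ∃ c₀ : ℕ, ∀ c : ℕ, c₀ ≤ c → ∀ α : ℝ, α ≤ 1 / 2 → ∀ j : ℕ, 5 ≤ j →
      (∃ x ∈ (EvsSIZE U c α).yes, x.length = 2 ^ (2 * j)) ∧
        (∃ x ∈ (EvsSIZE U c α).no, x.length = 2 ^ (2 * j)) := by
  obtain ⟨c₀, hc₀⟩ := exists_forall_ones_mem_EvsSIZE_yes U
  refine ⟨c₀, fun c hc α hα j hj => ⟨⟨ones (2 ^ (2 * j)), hc₀ c hc α (2 * j) (by omega), ?_⟩, ?_⟩⟩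
  · simp [ones]
  · obtain ⟨f, hf⟩ := exists_truthTable_mem_EvsSIZE_no U c hα hj
    exact ⟨truthTable f, hf, length_truthTable f⟩

/-! ### The hitting-set-generator notion is a genuine constraint -/

/-- The inputs with first bit `true` are exactly half of `{0,1}^{n+1}`. [folklore] -/
theorem card_filter_apply_zero_eq (n : ℕ) :
    (Finset.univ.filter fun u : Fin (n + 1) → Bool => u 0 = true).card = 2 ^ n := by
  classical
  have himage : (Finset.univ.filter fun u : Fin (n + 1) → Bool => u 0 = true) =
      Finset.univ.image (fun v : Fin n → Bool => (Fin.cons true v : Fin (n + 1) → Bool)) := by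
    ext u
    simp only [Finset.mem_filter, Finset.mem_univ, true_and, Finset.mem_image]
    constructor
    · intro hu
      refine ⟨Fin.tail u, ?_⟩
      rw [← hu]
      exact Fin.cons_self_tail u
    · rintro ⟨v, rfl⟩
      simp
  rw [himage, Finset.card_image_of_injective _ (Fin.cons_right_injective _)]
  simp

/-- **The all-zero generator is not a hitting set generator** against linear-size `AC⁰_d ∘ XOR`
circuits, for any seed length: the gate-free circuit `x₀` (in `IsACdXor d (fun n ↦ n)` at every
length `n + 1`, sibling file's `isACdXor_input`) accepts exactly half of the inputs and rejects every
string starting with `0`. So `IsHittingSetGeneratorAgainst (IsACdXor d ·)` is not vacuously satisfiable.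
[folklore] -/
theorem not_isHittingSetGeneratorAgainst_zero (d : ℕ) (ℓ : ℕ → ℕ) :
    ¬ IsHittingSetGeneratorAgainst (IsACdXor d fun n => n)
        (fun n _ => List.replicate n false) ℓ := by
  classical
  intro h
  obtain ⟨n₀, hn₀⟩ := eventually_atTop.1 h
  have hbad := hn₀ (n₀ + 1) (Nat.le_succ _) (Circuit.input (0 : Fin (n₀ + 1)))
    (isACdXor_input d (fun n => n) n₀)
  apply hbad
  refine ⟨?_, ?_⟩
  · have hev : (Finset.univ.filter fun u : Fin (n₀ + 1) → Bool =>
        (Circuit.input (0 : Fin (n₀ + 1))).eval u = true) =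
        (Finset.univ.filter fun u : Fin (n₀ + 1) → Bool => u 0 = true) := by
      ext u
      simp [Circuit.eval_input]
    rw [hev, card_filter_apply_zero_eq, pow_succ]
    omega
  · rintro u ⟨z, -, rfl⟩
    simp [Circuit.eval_input, toInput]

/-! ### Consequences: Item 1 ⟹ Item 4 for every machine; R29 at all depths ⟹ `EXP ⊄ NC¹` -/

/-- **Item 1 ⟹ Item 4 of Thm. 1.11, for EVERY reference machine** (from Prop. 4.22): the
`MKtP[c log N, N − 1]` bound of Prop. 4.22 is a bound for `MKtP[c log N, N^α]` for any `0 < α < 1`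
(here `α = 1/2`), since eventually `⌊N^α⌋ < N − 1` makes the latter's NO side contain the former's
(sibling file's `eventually_powThreshold_lt_predThreshold`). [cite: Hirahara2023NonDisjoint, proof of Thm. 1.11 (p. 44)] -/
theorem thm111Item4_of_item1 (h422 : prop422_acdXor) (h1 : Thm111Item1) (U : UniversalMachine) :
    Thm111Item4 U := by
  intro d k
  obtain ⟨c, hc⟩ := h422 U d (h1 d) k
  refine ⟨c, 1 / 2, by norm_num, ?_⟩
  obtain ⟨N₀, hN₀⟩ := eventually_atTop.1
    (eventually_powThreshold_lt_predThreshold (by norm_num : (1 : ℝ) / 2 < 1))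
  refine hc.of_imp ⟨N₀, fun x hx => ⟨fun hy => hy, fun hn => ?_⟩⟩
  rw [UniversalMachine.mem_gapMKtP_no_iff] at hn ⊢
  exact lt_of_le_of_lt (by exact_mod_cast (hN₀ x.length hx).le) hn

/-- **Thm. 4.29 at all depths gives Item 1**, for the machine `U`. [cite: Hirahara2023NonDisjoint, Thm. 4.29, Thm. 1.11 (2 ⟹ 1, p. 44)] -/
theorem thm111Item1_of_forall_thm429Hypothesis (h429 : thm429) (U : UniversalMachine)
    (hU : ∀ d : ℕ, Thm429Hypothesis U d) : Thm111Item1 :=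
  fun d => h429 U d (hU d)

/-- **Magnification of R29 to `EXP ⊄ NC¹`**: if for ONE reference machine `U` and EVERY depth `d` some
`E^c vs SIZE(2^{αn})` has no `AC⁰_{d+1} ∘ XOR` circuits of size `N^{1+β}` along powers of two, then
(Thm. 4.29) hitting set generators against every `AC⁰_d ∘ XOR` exist, hence (Prop. 4.22) Item 4 and
Item 3 of Thm. 1.11 hold for every machine, hence (the author's remark on Item 1, sibling file's
`thm111_consequence`) `EXP ⊄ NC¹`. [cite: Hirahara2023NonDisjoint, Thm. 1.11 and the remark after it (p. 10)] -/
theorem not_EXP_subset_NC1_of_thm429Hypothesis (h429 : thm429) (h422 : prop422_acdXor)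
    (hC : thm111_consequence) (U : UniversalMachine) (hU : ∀ d : ℕ, Thm429Hypothesis U d) :
    ¬ (EXP ⊆ NC1) :=
  hC U (thm111Item3_of_item4 U
    (thm111Item4_of_item1 h422 (thm111Item1_of_forall_thm429Hypothesis h429 U hU) U))

/-- Machine-independence made explicit: the R29 hypothesis for one machine `U` gives Item 4 of
Thm. 1.11 for ANY machine `U'` (the hitting set generator does not mention a machine). [folklore] -/
theorem thm111Item4_of_forall_thm429Hypothesis (h429 : thm429) (h422 : prop422_acdXor)
    (U U' : UniversalMachine) (hU : ∀ d : ℕ, Thm429Hypothesis U d) : Thm111Item4 U' :=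
  thm111Item4_of_item1 h422 (thm111Item1_of_forall_thm429Hypothesis h429 U hU) U'

end Literature.Computability.MetaComplexity.Hirahara2020
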